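import Mathlib
import HarnessLib
import HarnessLib.Audit
import Summits.Langlands.Langlands.Theorems.WeakStrongBridge
import Literature.NumberTheory.Automorphic.CMEllipticCurveAutomorphyTotallyReal
import Summits.Langlands.Langlands.Theorems.QuarticLiftSplit
import Summits.Langlands.Langlands.Theses.SqrtFiveQuarticCovers

/-!
# WeakStrongBridgeQuarticLift — lens-5 residual chain, one storey up: kit 6's OPEN binder Q5A from the LIVE weak item
(lens-5 g37, kit 7, file B of 2; imports file A `WeakStrongBridge`)

THESIS (residual mode, target = `TowerDoorSplit.UnanchoredHighDegreeWitnessAutomorphy`, stmt-Langlands-26998, DECLARED RESIDUAL).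
Kit 6 (`QuarticLiftSplit`, p839706) closed the quartic-`√5` half of the residual range modulo ONE open non-print binder
Q5A = `QuarticLiftSplit.SqrtFiveQuarticAutomorphy` (STRONG automorphy of every integral curve over a totally real quartic field
containing `√5`).  With file A's weak ⟹ strong bridge, Q5A is DISCHARGED into
  (i)  the LIVE weak item `EllipticDegreeLadder.QuarticModularity` (stmt-Langlands-17832; = lg-quartmod's route target
       `SqrtFiveQuarticCovers.Target` DEFINITIONALLY, `target_iff_quarticModularity`) — an EDGE to an existing item, by name;
  (ii) three tree-named print facts `h27`, `hirr`, `hCar` (file A);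
  (iii) ONE PRINT binder, the Literature named fact `CMAutomorphyTotallyReal` (CM curves over totally real fields are automorphic of weight zero:
       Deuring's `L(E/K,s) = L(s,ψ_{E/KM})` + Hecke–Jacquet–Langlands automorphic induction `π(ψ)`), needed because the weak item's
       CM branch carries no `π`.
`closes_byName` = kit 6's `closes_byName` with `hQ` replaced by `(h27 hirr hCar hCMA hQM)`: 22 → 26 binders, of which the only open
NON-print ones are the lineage's own (DBC, NSBC, the doors, `Residual40`, the EllipticDegreeLadder items) and the live item 17832.
Conversely `quarticModularity_of_box11_and_q5a`: `Box2022_theorem1_1 ∧ Q5A ⟹ QuarticModularity` — modulo Box Thm 1.1 and print, Q5A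
and the live weak item are EQUIVALENT (the residual did not grow; the non-print content moved onto a staffable item).

HONEST.  Conditional node; COUNT-NEUTRAL (no item closes); `CMAutomorphyTotallyReal` is a Literature named fact (unproved in the tree) used as a hypothesis
(not proved in the tree); nothing here proves a curve modular.
[cite: Deuring1953, Hauptsatz] [cite: SilvermanATAEC1994, Thm. II.10.5(b)] [cite: Gelbart1975, Thm. 7.11] [cite: JacquetLanglands1970, §12]
-/

set_option linter.dupNamespace false -- project-wide option; `Summit.Langlands.Langlands` is the mandated namespace

open scoped NumberField MatrixGroups Matrix
open NumberField Field IsDedekindDomain Polynomial Filter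
open Literature.NumberTheory.Automorphic
open Literature.NumberTheory.GaloisRepresentations
open Literature.NumberTheory.EllipticCurves

open Summit.Langlands.Langlands.Theorems.WeakStrongBridge

namespace Summit.Langlands.Langlands.Theorems.WeakStrongBridgeQuarticLift

/-! ## §4  Kit 6's OPEN binder Q5A from the LIVE weak item + named print facts (via file A) -/

section Residual

open Summit.Langlands.Langlands.Theorems.DepthIsolationSplit (IntegralModelTransferPointwise)
open Summit.Langlands.Langlands.Theorems.JDegreeFilterSplit (RatBaseChangeModularity SmallFieldBaseChange)
open Summit.Langlands.Langlands.Theorems.DyadicDoorSplit (AllenDyadicCorollary)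
open Summit.Langlands.Langlands.Theorems.OddPrimeDoorSplit (SkinnerWilesDihedralDoor PanZhangSupersingularDoor)
open Summit.Langlands.Langlands.Theorems.ReductionSignatureSplit (NearlyOrdinaryDihedralDoorThree
  SplitOrdinaryDihedralDoor MixedSignatureDoor)
open Summit.Langlands.Langlands.Theorems.NearlyOrdinaryDistinguishedSplit (NearlyOrdinaryDistinguishedDoor)
open Summit.Langlands.Langlands.Theorems.RelativeFifteenSplit (RelativeFifteenDoor)
open Summit.Langlands.Langlands.Theorems.RelativeSevenSplit (RelativeSevenDoor)
open Summit.Langlands.Langlands.Theorems.QuarticLiftSplit (SqrtFiveQuarticAutomorphy Residual40)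

/-! `CMAutomorphyTotallyReal` (CM curves over totally real fields are automorphic of weight zero — Deuring +
automorphic induction) is the Literature named fact `Literature.NumberTheory.Automorphic.CMAutomorphyTotallyReal`
(`CMEllipticCurveAutomorphyTotallyReal.lean`), taken here as the hypothesis `hCMA`. -/

/-- The live weak item is ONE statement under two route names: lg-quartmod's `SqrtFiveQuarticCovers.Target` IS
`EllipticDegreeLadder.QuarticModularity` (item stmt-Langlands-17832), definitionally. [folklore] -/
theorem target_iff_quarticModularity :
    Summit.Langlands.Langlands.Theses.SqrtFiveQuarticCovers.Target ↔
      Summit.Langlands.Langlands.Theses.EllipticDegreeLadder.QuarticModularity :=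
  Iff.rfl

/-- **Q5A ⟸ weak quartic modularity ∧ CMA ∧ (h27, hirr, hCar).**  Kit 6's open binder `SqrtFiveQuarticAutomorphy`
(strong, Hecke-polynomial automorphy of every integral curve over a totally real quartic field containing `√5`) follows from
the LIVE weak item `QuarticModularity` (stmt-Langlands-17832: CM, or a weight-zero `π` with `T_w`-eigenvalue `a_w(E)` at
almost all `w`) by the weak ⟹ strong bridge of §3 on the `π`-branch and the print binder CMA on the CM branch. -/
theorem sqrtFiveQuarticAutomorphy_of_weak
    (h27 : exists_galoisRep_of_regularAlgebraic) (hirr : galoisRep_GL2_totallyReal_irreducible)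
    (hCar : Carayol1986_unramifiedCompatibility) (hCMA : CMAutomorphyTotallyReal)
    (hQM : Summit.Langlands.Langlands.Theses.EllipticDegreeLadder.QuarticModularity) :
    SqrtFiveQuarticAutomorphy := by
  intro K _ _ hTR hdeg _h5 E hΔ
  rcases hQM K hTR hdeg E hΔ with hCM | ⟨hcpt, π, h0, hweak⟩
  · exact hCMA K E hΔ hCM
  · exact ⟨hcpt, π, h0, isAutomorphicOfWeightZero_of_weak h27 hirr hCar hTR hΔ π h0 hweak⟩

/-- The same from lg-quartmod's route target, by name. -/
theorem sqrtFiveQuarticAutomorphy_of_target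
    (h27 : exists_galoisRep_of_regularAlgebraic) (hirr : galoisRep_GL2_totallyReal_irreducible)
    (hCar : Carayol1986_unramifiedCompatibility) (hCMA : CMAutomorphyTotallyReal)
    (hT : Summit.Langlands.Langlands.Theses.SqrtFiveQuarticCovers.Target) : SqrtFiveQuarticAutomorphy :=
  sqrtFiveQuarticAutomorphy_of_weak h27 hirr hCar hCMA (target_iff_quarticModularity.1 hT)

/-- Conversely the strong binder gives the weak item on the `√5` half, and Box 2022 Thm 1.1 gives it off `√5`:
`Box2022_theorem1_1 ∧ Q5A ⟹ QuarticModularity` (so, modulo Box Thm 1.1 and the print facts, Q5A and the live weak item are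
EQUIVALENT — the residual did not grow). -/
theorem quarticModularity_of_box11_and_q5a (hBox : Box2022_theorem1_1) (hQ : SqrtFiveQuarticAutomorphy) :
    Summit.Langlands.Langlands.Theses.EllipticDegreeLadder.QuarticModularity := by
  intro K _ _ hTR hdeg E hΔ
  haveI := hTR
  exact IsModularEllipticCurve.of_isAutomorphicOfWeightZero hΔ
    (Summit.Langlands.Langlands.Theorems.QuarticLiftSplit.quartic_automorphy_of_box11_and_q5a hBox hQ K hdeg E hΔ)

/-- **closes, BY NAME, one storey up the lineage**: kit 6's `QuarticLiftSplit.closes_byName` with its OPEN non-print binder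
`hQ : SqrtFiveQuarticAutomorphy` DISCHARGED into (three tree-named print facts `h27`, `hirr`, `hCar`) + (the Literature named fact
binder CMA) + (the LIVE weak item `QuarticModularity` = stmt-Langlands-17832).  Conclusion: the lens-5 target
`TowerDoorSplit.UnanchoredHighDegreeWitnessAutomorphy` (stmt-Langlands-26998), literally. -/
theorem closes_byName (hDBC : RatBaseChangeModularity) (hNSBC : SmallFieldBaseChange)
    (hFLS : FLS2015_theorem1) (hDNS : DNS2020_theorem4) (hBox : Box2022_theorem1_1)
    (hADC : AllenDyadicCorollary) (h34 : FLS2015_theorems3_4) (hSW : SkinnerWilesDihedralDoor)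
    (hPZ : PanZhangSupersingularDoor) (hNO3 : NearlyOrdinaryDihedralDoorThree) (hNOS : SplitOrdinaryDihedralDoor)
    (hMIX : MixedSignatureDoor) (hNOD : NearlyOrdinaryDistinguishedDoor) (hB : Box2022_theorem1_3)
    (hRFD : RelativeFifteenDoor) (hRSD : RelativeSevenDoor)
    (h27 : exists_galoisRep_of_regularAlgebraic) (hirr : galoisRep_GL2_totallyReal_irreducible)
    (hCar : Carayol1986_unramifiedCompatibility) (hCMA : CMAutomorphyTotallyReal)
    (hQM : Summit.Langlands.Langlands.Theses.EllipticDegreeLadder.QuarticModularity) (hR : Residual40)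
    (hIMT : IntegralModelTransferPointwise)
    (hTr : Summit.Langlands.Langlands.Theses.EllipticDegreeLadder.EllipticTransportAnyBase)
    (hW : Summit.Langlands.Langlands.Theses.EllipticDegreeLadder.SatakeAvatarExistence)
    (h1 : Summit.Langlands.Langlands.Theses.EllipticDegreeLadder.RankOneAutomorphy) :
    Summit.Langlands.Langlands.Theses.TowerDoorSplit.UnanchoredHighDegreeWitnessAutomorphy :=
  Summit.Langlands.Langlands.Theorems.QuarticLiftSplit.closes_byName hDBC hNSBC hFLS hDNS hBox hADC h34 hSW hPZ hNO3
    hNOS hMIX hNOD hB hRFD hRSD (sqrtFiveQuarticAutomorphy_of_weak h27 hirr hCar hCMA hQM) hR hIMT hTr hW h1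

end Residual

end Summit.Langlands.Langlands.Theorems.WeakStrongBridgeQuarticLift
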